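import Summits.ResolutionOfSingularities.ResolutionOfSingularities.Theorems.DeltaCutStellarWild

/-!
# StellarCut R22a — «LowResidue»: the LOW-RESIDUE LABELLED class `ncHypShapeLow p n`, star-stable at EVERY marking `p ∣ n`,
# and its list law (lens-6 «barrier-complement carving», g36 door 3; family (iii) «n = p·m» of the critic's WINDOW g37/g38)

Route `MaxContactCut`, column `E1TopNoAbs`; decomposition lineage `decomp-res-lens-6`.

T18's coprime cell (`DeltaCutStellarWild`) is typed at the PURE-CHARACTERISTIC marking `p = n`; its docstring records the
composite levels `n = p·m`, `m ≥ 2`, as VACUOUS, and the g34 witness (`p = 2`, `n = 4`, labels `(3, 3) ↦ 2`) shows why: the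
condition «every label is `0` or prime to `p`» is NOT stable under Kollár's star phases at a composite marking — an `r`-face,
`r ≥ 3`, creates a new label `< n`, which may be `≡ 0 (mod p)`.

THE LEVER OF THIS FILE: the RESIDUE OF THE LABEL MODULO THE MARKING.  The class condition on every exponent `a` of the
labelled boundary is

  `a = 0 ∨ (0 < a % n ∧ a % n < p)`      («low residue»).

* §LowShape — `ncHypShapeLow p n` := `ncHypShapeF n` (T17a) ∧ `p` prime ∧ `p ∣ n` ∧ `2 ≤ n` ∧ `p = 0` in every stalk ∧ low
  residues along the members.  EVERY FACE IS SAFE (`ncHypShapeLow.safeFace`): `0 < a % n < p` with `p ∣ n` forces `p ∤ a`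
  (`Nat.dvd_mod_iff`), so `a` is a stalk unit (T15 `isUnit_natCast_of_cast_prime_eq_zero`).
* §Labels — ★ `low_weightOf_sub_of_starBelowH`: ALONG THE STAR PHASES THE NEW LABEL `weightOf E T − n` IS LOW, at an
  ARBITRARY marking: phase `r = 2` (`T = {H, K}`, `a_K ≥ n`): `a_K − n` has the residue of `a_K`; phase `r ≥ 3`: every member of
  `T` is light (`a_K ≤ weightOf E {H, K} < n`, so `a_K = a_K % n < p`) and minimality (`weightOf E (T ∖ K) < n`) gives
  `weightOf E T − n < a_K < p ≤ n` — the new label is `0` or is its own residue, in `(0, p)`.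
* §Round — `ncHypShapeLow.transform_star`: the class survives a strategy round (shape by T17b's safe-face round lemma
  `ncHypShapeF.transform_of_safe` BY NAME; `p = 0`, `p ∣ n`, `2 ≤ n` carried; exponents of the new boundary by
  `weightOf_transformExp` / `strictTransformIdeal_ne_comap` / `eq_of_strictTransformIdeal_eq` BY NAME — a re-instantiated copy
  of T18's bookkeeping, declared 0-weight; the class is kept by §Labels), `faceStableShapeStar_ncHypShapeLow`, and the LIST LAW
  `ncHypShapeLow.exists_weakResolution` = T16 `FaceStableShapeStar.exists_weakResolution` BY NAME.

AT `p = n` the condition reads `a = 0 ∨ p ∤ a`: the class IS T18's coprime class there (`ncHypShapeLow.toCop`,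
`ncHypShapeCop.toLow`); the content of the class is at the COMPOSITE markings.  NOT in the class (and not claimed): labels of
residue `0` (`h⁴ + u·z⁴` in characteristic `2`: the composite-marking kangaroo of the `h`-chart) or `≥ p` (the g34 witness
`(3, 3)` at `n = 4`).

0 sorry; axioms standard. [new] [cite: Kollar2007, (3.111) Step 3] [cite: CossartPiltant2008, Prop. 4.2 (a)]
-/

noncomputable section

open CategoryTheory CategoryTheory.Limits AlgebraicGeometry TopologicalSpace IsLocalRing
open Literature.AlgebraicGeometry.Resolution

namespace Summit.ResolutionOfSingularities.ResolutionOfSingularities.Theorems.DeltaCutClasses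

open Summit.ResolutionOfSingularities.ResolutionOfSingularities.Theorems
open WeakOrderReduction ForcedTowerClasses

/-! ### §LowShape — the low-residue labelled shape -/

section LowShape

variable {X : Scheme.{0}} {E : List (X.IdealSheafData × ℕ)} {H : X.IdealSheafData} {p n : ℕ} {M : MarkedIdeal X}

/-- **a low residue forbids divisibility**: `p ∣ n`, `0 < a % n < p` ⇒ `p ∤ a`. [folklore] -/
theorem not_dvd_of_mod_pos_of_mod_lt {p n a : ℕ} (hpn : p ∣ n) (h0 : 0 < a % n) (hlt : a % n < p) : ¬ p ∣ a :=
  fun h => absurd (Nat.le_of_dvd h0 ((Nat.dvd_mod_iff hpn).mpr h)) (not_le.mpr hlt)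

/-- at `n = p`: `a = 0 ∨ p ∤ a` iff the residue of `a` is low. [folklore] -/
theorem eq_zero_or_not_dvd_iff_low {p a : ℕ} (hp : p.Prime) :
    (a = 0 ∨ ¬ p ∣ a) ↔ (a = 0 ∨ (0 < a % p ∧ a % p < p)) := by
  refine or_congr_right ⟨fun h => ⟨Nat.pos_of_ne_zero fun h0 => h (Nat.dvd_of_mod_eq_zero h0), Nat.mod_lt a hp.pos⟩,
    fun h => not_dvd_of_mod_pos_of_mod_lt (dvd_refl p) h.1 h.2⟩

/-- **THE LOW-RESIDUE SHAPE `ncHypShapeLow p n`** (a `Shape`): the unit-free hypersurface shape at marking `n` (T17a), `p` prime,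
`p ∣ n`, `2 ≤ n`, `p = 0` in every stalk, and the exponent `a` of every boundary member `K` satisfies, along `V(K)`,
`a = 0 ∨ (0 < a % n ∧ a % n < p)`. DEFINITION (letter · intrinsic: T17a's shape and the exponents of `E` only). -/
def ncHypShapeLow (p n : ℕ) : Shape := fun X E H M =>
  ncHypShapeF n X E H M ∧ p.Prime ∧ p ∣ n ∧ 2 ≤ n ∧ (∀ x : X, ((p : ℕ) : X.presheaf.stalk x) = 0) ∧
    ∀ (K : X.IdealSheafData) (y : X), y ∈ K.support → expOf E K = 0 ∨ (0 < expOf E K % n ∧ expOf E K % n < p)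

namespace ncHypShapeLow

/-- the underlying unit-free shape -/
theorem toF (hP : ncHypShapeLow p n X E H M) : ncHypShapeF n X E H M := hP.1

/-- `p` is prime -/
theorem prime (hP : ncHypShapeLow p n X E H M) : p.Prime := hP.2.1

/-- `p` divides the marking -/
theorem dvd (hP : ncHypShapeLow p n X E H M) : p ∣ n := hP.2.2.1

/-- the marking is at least `2` -/
theorem two_le (hP : ncHypShapeLow p n X E H M) : 2 ≤ n := hP.2.2.2.1

/-- `p = 0` in every stalk -/
theorem cast_eq_zero (hP : ncHypShapeLow p n X E H M) (x : X) : ((p : ℕ) : X.presheaf.stalk x) = 0 := hP.2.2.2.2.1 x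

/-- the exponents have low residues along their divisors -/
theorem labels (hP : ncHypShapeLow p n X E H M) {K : X.IdealSheafData} {y : X} (hy : y ∈ K.support) :
    expOf E K = 0 ∨ (0 < expOf E K % n ∧ expOf E K % n < p) := hP.2.2.2.2.2 K y hy

/-- the exponents are `0` or prime to `p` along their divisors -/
theorem labels_not_dvd (hP : ncHypShapeLow p n X E H M) {K : X.IdealSheafData} {y : X} (hy : y ∈ K.support) :
    expOf E K = 0 ∨ ¬ p ∣ expOf E K :=
  (hP.labels hy).imp_right fun h => not_dvd_of_mod_pos_of_mod_lt hP.dvd h.1 h.2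

/-- ★ **EVERY FACE OF A LOW-RESIDUE DATUM IS SAFE** (T17a `SafeFace`, third disjunct; T15). [new] -/
theorem safeFace (hP : ncHypShapeLow p n X E H M) (T : Finset X.IdealSheafData) : SafeFace n X E T :=
  Or.inr (Or.inr fun _ _ y hy => (hP.labels_not_dvd hy).imp_right fun h =>
    isUnit_natCast_of_cast_prime_eq_zero hP.prime (hP.cast_eq_zero y) h)

/-- **AT THE PURE-CHARACTERISTIC MARKING the low-residue class is T18's coprime class.** [new] -/
theorem toCop (hP : ncHypShapeLow p p X E H M) : ncHypShapeCop p X E H M :=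
  ⟨hP.toF, hP.prime, hP.cast_eq_zero, fun _ _ hy => hP.labels_not_dvd hy⟩

end ncHypShapeLow

/-- **conversely, a coprime datum (T18, marking `p`) is a low-residue datum at `n = p`.** [new] -/
theorem ncHypShapeCop.toLow (hP : ncHypShapeCop p X E H M) : ncHypShapeLow p p X E H M :=
  ⟨hP.toF, hP.prime, dvd_refl p, hP.prime.two_le, hP.cast_eq_zero,
    fun _ _ hy => (eq_zero_or_not_dvd_iff_low hP.prime).mp (hP.labels hy)⟩

end LowShape

/-! ### §Labels — the new label along the star phases, ARBITRARY marking -/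

section Labels

variable {X : Scheme.{0}} {E : List (X.IdealSheafData × ℕ)} {H : X.IdealSheafData} {T : Finset X.IdealSheafData} {p n : ℕ}

/-- ★ **THE NEW LABEL STAYS LOW ALONG THE STAR PHASES, AT EVERY MARKING.**  For an `r`-set `T ∋ H` of boundary members with the
`H`-exponent `0`, low residues on `T`, and the star bounds `(*ₛ)^H` (`s < r`): the new label `weightOf E T − n` is `0` or has residue
in `(0, p)` — phase `r = 2`: it is `a_K − n ≡ a_K (mod n)`; phase `r ≥ 3`: `a_K ≤ weightOf E {H, K} < n` (so `a_K = a_K % n < p`)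
and `weightOf E T = a_K + weightOf E (T ∖ K) < a_K + n`, so `weightOf E T − n < a_K < p ≤ n`. [new]
[cite: Kollar2007, (3.111) Step 3] -/
theorem low_weightOf_sub_of_starBelowH {r : ℕ} (hTrH : T ∈ incSubsetsH E H r) (hstar : StarBelowH E H n r)
    (hH0 : expOf E H = 0) (hlow : ∀ K ∈ T, expOf E K = 0 ∨ (0 < expOf E K % n ∧ expOf E K % n < p)) :
    weightOf E T - n = 0 ∨ (0 < (weightOf E T - n) % n ∧ (weightOf E T - n) % n < p) := by
  classical
  obtain ⟨hTr, hHT⟩ := mem_incSubsetsH_iff.mp hTrH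
  obtain ⟨hTs, hcard, x, hx⟩ := mem_incSubsets_iff.mp hTr
  rcases Nat.lt_or_ge n (weightOf E T) with hlt | hge
  swap
  · exact Or.inl (Nat.sub_eq_zero_of_le hge)
  -- `weightOf E T = weightOf E (T.erase H)`
  set S := T.erase H with hS
  have hWS : weightOf E T = weightOf E S := by
    have h := weightOf_insert E (Finset.notMem_erase H T) (K := H)
    rw [Finset.insert_erase hHT, hH0, zero_add] at h
    exact h
  by_cases hS1 : S.card ≤ 1
  · -- phase `r ≤ 2`: `S = ∅` or `S = {K}`
    obtain ⟨K, hSK⟩ := Finset.card_le_one_iff_subset_singleton.mp hS1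
    rcases Finset.subset_singleton_iff.mp hSK with hS0 | hSeq
    · rw [hWS, hS0, weightOf_empty] at hlt
      exact absurd hlt (Nat.not_lt_zero n)
    · have hKS : K ∈ S := by rw [hSeq]; exact Finset.mem_singleton_self K
      have hKT : K ∈ T := Finset.mem_of_mem_erase hKS
      have hWK : weightOf E T = expOf E K := by rw [hWS, hSeq]; rfl
      rcases hlow K hKT with h0 | ⟨hpos, hltp⟩
      · rw [hWK, h0] at hlt
        exact absurd hlt (Nat.not_lt_zero n)
      · obtain ⟨d, hd⟩ := Nat.exists_eq_add_of_le (hWK ▸ hlt).le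
        have hsub : weightOf E T - n = d := by omega
        rw [hd, Nat.add_mod_left] at hpos hltp
        rw [hsub]
        exact Or.inr ⟨hpos, hltp⟩
  · -- phase `r ≥ 3`: the star bounds
    push Not at hS1
    obtain ⟨K, hKS⟩ : S.Nonempty := Finset.card_pos.mp (by omega)
    have hKT : K ∈ T := Finset.mem_of_mem_erase hKS
    have hKH : K ≠ H := Finset.ne_of_mem_erase hKS
    have hST : S.card + 1 = T.card := Finset.card_erase_add_one hHT
    have hr3 : 3 ≤ r := by omega
    have h1 : weightOf E (T.erase K) < n :=
      hstar (r - 1) (by omega) _ (mem_incSubsets_iff.mpr ⟨(Finset.erase_subset K T).trans hTs,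
        by rw [Finset.card_erase_of_mem hKT, hcard], x, fun K' hK' => hx K' (Finset.mem_of_mem_erase hK')⟩)
        (Finset.mem_erase.mpr ⟨hKH.symm, hHT⟩)
    have h2 : weightOf E {H, K} < n := by
      refine hstar 2 (by omega) _ (mem_incSubsets_iff.mpr ⟨?_, Finset.card_pair hKH.symm, x, fun K' hK' => ?_⟩)
        (Finset.mem_insert_self H {K})
      · exact Finset.insert_subset_iff.mpr ⟨hTs hHT, Finset.singleton_subset_iff.mpr (hTs hKT)⟩
      · rcases Finset.mem_insert.mp hK' with rfl | hK'
        · exact hx _ hHT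
        · rw [Finset.mem_singleton.mp hK']; exact hx _ hKT
    have hWK : weightOf E T = expOf E K + weightOf E (T.erase K) := by
      have h := weightOf_insert E (Finset.notMem_erase K T) (K := K)
      rw [Finset.insert_erase hKT] at h
      exact h
    have hKle : expOf E K ≤ weightOf E {H, K} := weightOf_mono E (Finset.subset_insert H {K})
    have hKn : expOf E K < n := lt_of_le_of_lt hKle h2
    have hsub : weightOf E T - n < expOf E K := by omega
    rcases hlow K hKT with h0 | ⟨hpos, hltp⟩
    · omega
    · rw [Nat.mod_eq_of_lt hKn] at hpos hltp
      by_cases hz : weightOf E T - n = 0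
      · exact Or.inl hz
      · refine Or.inr ?_
        rw [Nat.mod_eq_of_lt (lt_trans hsub hKn)]
        exact ⟨Nat.pos_of_ne_zero hz, lt_trans hsub hltp⟩

end Labels

/-! ### §Round — the low-residue shape survives a STRATEGY round; the list law -/

section Round

variable {X X' : Scheme.{0}} [IsLocallyNoetherian X] {π : X' ⟶ X} {H : X.IdealSheafData}
  {E : List (X.IdealSheafData × ℕ)} {T : Finset X.IdealSheafData} {p n : ℕ} {M : MarkedIdeal X}

/-- ★ **THE LOW-RESIDUE SHAPE SURVIVES A STRATEGY ROUND** (any marking `p ∣ n`): the blow-up of the face of an `r`-set `T ∋ H` of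
weight `≥ n` in phase `r`.  Shape: the safe-face round lemma (T17b; every face of a low-residue datum is safe); `p = 0` transported by
the stalk maps; exponents of the new boundary: a strict transform keeps `expOf E K` (`eq_of_strictTransformIdeal_eq`), the exceptional
divisor gets `weightOf E T − n` (`weightOf_transformExp`, `strictTransformIdeal_ne_comap`), which §Labels keeps low.  (Bookkeeping =
T18's `ncHypShapeCop.transform_star` re-instantiated; declared 0-weight.) [new] [cite: Kollar2007, (3.111) Step 3] -/
theorem ncHypShapeLow.transform_star {r : ℕ} (hEs : HasSNC (H :: boundaryOf E)) (hT : ∀ K ∈ T, K ∈ H :: boundaryOf E)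
    (hHT : H ∈ T) (hπ : IsBlowup π (T.sup id)) (hmT : n ≤ weightOf E T) (hTrH : T ∈ incSubsetsH E H r)
    (hstar : StarBelowH E H n r) (hP : ncHypShapeLow p n X E H M) :
    ncHypShapeLow p n X' (transformExp E π T n) (strictTransformIdeal π (T.sup id) H) (M.transform π (T.sup id)) := by
  classical
  haveI : IsProper π := hπ.isProper
  haveI : IsLocallyNoetherian X' := LocallyOfFiniteType.isLocallyNoetherian π
  refine ⟨hP.toF.transform_of_safe hEs hT hHT hπ hmT hP.two_le (hP.safeFace T), hP.prime, hP.dvd, hP.two_le, fun x' => ?_,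
    fun G x' hx' => ?_⟩
  · have h := congrArg (π.stalkMap x').hom (hP.cast_eq_zero (π x'))
    rwa [map_natCast, map_zero] at h
  · -- the exponents of the new boundary members through `x'`
    rw [expOf, weightOf_transformExp]
    by_cases hGF : (T.sup id).comap π ∈ ({G} : Finset X'.IdealSheafData)
    · -- the exceptional divisor: exponent `weightOf E T − n`
      have hGF' : (T.sup id).comap π = G := Finset.mem_singleton.mp hGF
      rw [if_pos hGF]
      have hxF : x' ∈ ((T.sup id).comap π).support := by rw [hGF']; exact hx'
      have hxC : π x' ∈ (T.sup id).support := by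
        have h : x' ∈ ((((T.sup id).comap π).support : Set X')) := hxF
        rwa [Scheme.IdealSheafData.support_comap] at h
      have hyT : ∀ K ∈ T, π x' ∈ K.support := (mem_support_finsetSup_iff T (π x')).mp hxC
      have hpre : pre E π T {G} = ∅ := by
        refine Finset.eq_empty_of_forall_notMem fun K hK => ?_
        obtain ⟨hKs, hKG⟩ := mem_pre_iff.mp hK
        rw [Finset.mem_singleton, ← hGF'] at hKG
        exact strictTransformIdeal_ne_comap hEs hT hπ (List.mem_cons_of_mem _ (mem_sheaves_iff.mp hKs)) hxF hKG
      rw [hpre, weightOf_empty, zero_add]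
      have hH0 : expOf E H = 0 := expOf_eq_zero_of_labels fun q hq hqH =>
        (hP.toF.label_eq_zero hq hqH).resolve_right (Set.nonempty_iff_ne_empty.mp ⟨π x', hyT H hHT⟩)
      exact low_weightOf_sub_of_starBelowH hTrH hstar hH0 fun K hK => hP.labels (hyT K hK)
    · -- a strict transform: exponent `expOf E K` of the unique old member behind it
      rw [if_neg hGF, add_zero]
      by_cases hex : ∃ K, K ∈ pre E π T {G}
      · obtain ⟨K, hK⟩ := hex
        obtain ⟨hKs, hKG⟩ := mem_pre_iff.mp hK
        rw [Finset.mem_singleton] at hKG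
        have hxK' : x' ∈ (strictTransformIdeal π (T.sup id) K).support := by rw [hKG]; exact hx'
        have hxK : π x' ∈ K.support := mem_support_of_mem_support_strictTransformIdeal hxK'
        have hpre : pre E π T {G} = {K} := by
          refine Finset.eq_singleton_iff_unique_mem.mpr ⟨hK, fun K' hK' => ?_⟩
          obtain ⟨hK's, hK'G⟩ := mem_pre_iff.mp hK'
          rw [Finset.mem_singleton] at hK'G
          exact (eq_of_strictTransformIdeal_eq hEs hT hπ (List.mem_cons_of_mem _ (mem_sheaves_iff.mp hKs))
            (List.mem_cons_of_mem _ (mem_sheaves_iff.mp hK's)) hxK' (hKG.trans hK'G.symm)).symm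
        rw [hpre]
        exact hP.labels hxK
      · push Not at hex
        rw [Finset.eq_empty_of_forall_notMem fun K hK => hex K hK, weightOf_empty]
        exact Or.inl rfl

/-- ★ **THE LOW-RESIDUE SHAPE IS FACE-STABLE ALONG THE STRATEGY** (T16 `FaceStableShapeStar`, marking `n`). [new] -/
theorem faceStableShapeStar_ncHypShapeLow (p n : ℕ) : FaceStableShapeStar n (ncHypShapeLow p n) where
  round _ _ _ _ T _ _ hEs _ hT hHT hmT hTrH hstar hP :=
    hP.transform_star hEs hT hHT (blowup.isBlowup (T.sup id)) hmT hTrH hstar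
  face _ _ _ _ _ _ hEs hHT hmT hP := support_finsetSup_subset_support_ncHypShapeF hEs hHT hmT hP.toF
  terminal _ _ _ _ _ hEs _ hP h := support_ncHypShapeF_eq_empty (hasSNC_boundaryOf_of_cons hEs) hP.toF h

/-- ★★ **THE LIST LAW OF THE LOW-RESIDUE CLASS**: on a locally Noetherian scheme, a low-residue datum for a labelled boundary `E ∋ H`
with `H :: E` s.n.c. admits a weak resolution — Kollár's strategy through `H` (T16) BY NAME. [new] [cite: Kollar2007, (3.111) Step 3] -/
theorem ncHypShapeLow.exists_weakResolution (hEs : HasSNC (H :: boundaryOf E)) (hH : H ∈ boundaryOf E)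
    (hP : ncHypShapeLow p n X E H M) : ∃ s : CentreSeq X, WeakResolution s M :=
  (faceStableShapeStar_ncHypShapeLow p n).exists_weakResolution hEs hH M hP

end Round

end Summit.ResolutionOfSingularities.ResolutionOfSingularities.Theorems.DeltaCutClasses
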